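/-
Copyright: b2b-lace packet (tail-bound analyst, gen 2). Kernel PCM, part B (LEMMAS N43a): parity-class
monotonicity of every SRW integral `I_{n,l}` (d ≥ 2n+1), and the unconditional PCS reductions.
-/
import Literature.Probability.FitznerVanDerHofstad2017.SrwLawParity
import HarnessLib

/-!
# Kernel PCM, part B (LEMMAS N43a): parity-class monotonicity of every `I_{n,l}`

`I_{0,l}(x) = |W_d|⁻¹ Σ_σ p_l(σ x)` (the symmetrised transition function), so `I_{0,l}` is
parity-class monotone by part A; `I_{n+1,l} = Σ_{i<L} I_{n,l+i} + I_{n+1,l+L}` (the recursion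
(5.1)) with `I_{n+1,L}(x) → 0` (`|D̂| < 1` a.e., dominated convergence with majorant `Ĉ^{n+1}`),
and parity-class monotonicity passes to non-negative combinations and limits.  Consequences: the
UNCONDITIONAL forms of the PCS reductions of `SrwIntegralParityDomination`
(`srwK_le_sqrt_srwW_parityRep'`, `…_axis_three'`) and the step form
`srwI_parity_step : -1 ≤ y ι → I_{n,l}(y + 2e_ι) ≤ I_{n,l}(y)` (REFEREE v12 N43a).
-/

namespace Literature.Probability.FitznerVanDerHofstad2017

open MeasureTheory Real Finset Filter Topology
open scoped BigOperators
open Literature.Barriers.CriticalPhenomena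
open Literature.Barriers.CriticalPhenomena.Slade2006Prop53 (P)
open Literature.Probability.LatticeModels

variable {d : ℕ}

/-! ### `I_{0,l}` as a symmetrised transition function -/

/-- The phase `k·p(x;σ)` is `kdot k (σ x)`. [folklore] -/
theorem phase_eq_kdot (x : Fin d → ℤ) (k : Fin d → ℝ) (σ : SgnPermPair d) :
    phase x k σ = kdot k (spAct σ x) := by
  unfold phase kdot
  refine Finset.sum_congr rfl fun j _ => ?_
  rw [spAct_apply]
  push_cast
  ring

/-- `I_{0,l}(x) = (2^d d!)⁻¹ Σ_{σ ∈ W_d} p_l(σ x)`. [cite: FitznerVanDerHofstad2016NoBLE, (3.34)–(3.35) p. 1071] -/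
theorem srwI_zero_eq_sum_srwP (l : ℕ) (x : Fin d → ℤ) :
    srwI d 0 l x = (∑ σ : SgnPermPair d, srwP d l (spAct σ x)) / (2 ^ d * (d.factorial : ℝ)) := by
  unfold srwI srwP
  have hpt : ∀ k, (Dhat d k ^ l * DhatSym d x k) * Chat d 1 k ^ 0 =
      (∑ σ : SgnPermPair d, Dhat d k ^ l * Real.cos (kdot k (spAct σ x))) /
        (2 ^ d * (d.factorial : ℝ)) := by
    intro k
    rw [pow_zero, mul_one, DhatSym_eq_sum_pairs, mul_div_assoc', Finset.mul_sum]
    simp_rw [phase_eq_kdot]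
  simp_rw [hpt]
  rw [integral_div, integral_finsetSum _ (fun σ _ => integrable_Dhat_pow_mul_cos l _), div_right_comm,
    Finset.sum_div]

/-- The parity-domination relation is `W_d`-equivariant. [folklore] -/
theorem parityRel_spAct (σ : SgnPermPair d) {z z' : Fin d → ℤ}
    (h : ∀ μ, |z' μ| ≤ |z μ| ∧ (z μ - z' μ) % 2 = 0) (μ : Fin d) :
    |spAct σ z' μ| ≤ |spAct σ z μ| ∧ (spAct σ z μ - spAct σ z' μ) % 2 = 0 := by
  simp only [spAct_apply]
  obtain ⟨h1, h2⟩ := h (σ.1 μ)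
  rcases Int.units_eq_one_or (σ.2 μ) with hu | hu
  · rw [hu]; push_cast; simp only [one_mul]; exact ⟨h1, h2⟩
  · rw [hu]; push_cast; simp only [neg_mul, one_mul, abs_neg]
    refine ⟨h1, ?_⟩
    omega

/-- **PCM for `I_{0,l}`** (every `d`, every `l`). [folklore] -/
theorem parityMonotone_srwI_zero (l : ℕ) : ParityMonotone (srwI d 0 l) := by
  intro z z' h
  rw [srwI_zero_eq_sum_srwP, srwI_zero_eq_sum_srwP]
  apply div_le_div_of_nonneg_right _ (by positivity)
  exact Finset.sum_le_sum fun σ _ => parityMonotone_srwP l _ _ (parityRel_spAct σ h)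

/-! ### `|D̂| < 1` almost everywhere and `I_{n,L} → 0` -/

/-- Off the null set `{0} ∪ {±π}^d` of the cube, `|D̂(k)| < 1` (`d ≥ 1`). [folklore] -/
theorem ae_abs_Dhat_lt_one (hd : 1 ≤ d) : ∀ᵐ k ∂P d, |Dhat d k| < 1 := by
  haveI : Nonempty (Fin d) := ⟨⟨0, hd⟩⟩
  haveI : NullSingletonClass Slade2006Prop53.μI := by
    unfold Slade2006Prop53.μI; infer_instance
  haveI : NullSingletonClass (P d) := by unfold Slade2006Prop53.P; infer_instance
  set C : Set (Fin d → ℝ) := Set.range (fun s : Fin d → Bool => fun j => if s j then π else -π)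
    with hC
  have hC0 : P d C = 0 := (Set.finite_range _).measure_zero _
  have hnotC : ∀ᵐ k ∂P d, k ∉ C := compl_mem_ae_iff.mpr hC0
  have hcube : ∀ᵐ k ∂P d, k ∈ Set.pi Set.univ fun _ : Fin d => Set.Icc (-π) π := by
    rw [← Slade2006Prop53.volume_restrict_cube]
    exact ae_restrict_mem (MeasurableSet.univ_pi fun _ => measurableSet_Icc)
  filter_upwards [ae_Chat_mul_one_sub_Dhat hd, hnotC, hcube] with k hk hkC hkc
  rw [abs_lt]
  constructor
  · by_contra hle
    push Not at hle
    have hDeq : Dhat d k = -1 := le_antisymm hle (neg_one_le_Dhat k)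
    apply hkC
    have hsum : ∑ j, (1 + Real.cos (k j)) = 0 := by
      have hd' : (d : ℝ) ≠ 0 := by exact_mod_cast (by omega : d ≠ 0)
      have hs : (∑ j, Real.cos (k j)) = -d := by
        rw [Dhat_def] at hDeq
        field_simp at hDeq
        linarith
      rw [Finset.sum_add_distrib, hs]
      simp
    have hcos : ∀ j, Real.cos (k j) = -1 := by
      intro j
      have := (Finset.sum_eq_zero_iff_of_nonneg (fun j _ => by
        linarith [Real.neg_one_le_cos (k j)])).mp hsum j (Finset.mem_univ j)
      linarith
    refine ⟨fun j => decide (0 ≤ k j), funext fun j => ?_⟩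
    obtain ⟨m, hm⟩ := Real.cos_eq_neg_one_iff.mp (hcos j)
    obtain ⟨hlo, hhi⟩ := hkc j (Set.mem_univ j)
    have h2pi : (0 : ℝ) < 2 * π := by positivity
    have hm0 : (m : ℝ) ≤ 0 := by
      have : (m : ℝ) * (2 * π) ≤ 0 * (2 * π) := by linarith
      exact le_of_mul_le_mul_right this h2pi
    have hm1 : (-1 : ℝ) ≤ m := by
      have : (-1 : ℝ) * (2 * π) ≤ m * (2 * π) := by linarith
      exact le_of_mul_le_mul_right this h2pi
    have hm' : m = 0 ∨ m = -1 := by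
      have a : m ≤ 0 := by exact_mod_cast hm0
      have b : -1 ≤ m := by exact_mod_cast hm1
      omega
    simp only [decide_eq_true_eq]
    rcases hm' with rfl | rfl
    · push_cast at hm
      have hkj : k j = π := by linarith
      rw [if_pos (by rw [hkj]; positivity), hkj]
    · push_cast at hm
      have hkj : k j = -π := by linarith
      rw [if_neg (by rw [hkj]; linarith [Real.pi_pos]), hkj]
  · have hne : 1 - Dhat d k ≠ 0 := by
      intro h0
      rw [h0, mul_zero] at hk
      exact zero_ne_one hk
    exact lt_of_le_of_ne (Dhat_le_one k) (fun h => hne (by rw [h]; ring))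

/-- `I_{m,l+L}(x) → 0` as `L → ∞` (`d ≥ 2m + 1`): dominated convergence with majorant `Ĉ^m`,
`D̂^{l+L} → 0` a.e. [folklore] -/
theorem tendsto_srwI_shift_atTop {m : ℕ} (hd : 2 * m + 1 ≤ d) (l : ℕ) (x : Fin d → ℤ) :
    Tendsto (fun L : ℕ => srwI d m (l + L) x) atTop (𝓝 0) := by
  have hd1 : 1 ≤ d := by omega
  unfold srwI
  rw [show (0 : ℝ) = 0 / (2 * π) ^ d by simp]
  refine Tendsto.div_const ?_ _
  have hlim := tendsto_integral_of_dominated_convergence (μ := P d)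
    (F := fun (L : ℕ) k => (Dhat d k ^ (l + L) * DhatSym d x k) * Chat d 1 k ^ m)
    (f := fun _ => (0 : ℝ)) (fun k => Chat d 1 k ^ m)
    (fun L => (integrable_srwI_integrand hd (l + L) x).aestronglyMeasurable)
    (integrable_Chat_pow m hd zero_le_one le_rfl)
    (fun L => ae_of_all _ fun k => by
      rw [Real.norm_eq_abs, abs_mul, abs_mul, abs_pow,
        abs_of_nonneg (pow_nonneg (Chat_one_nonneg k) m)]
      exact mul_le_of_le_one_left (pow_nonneg (Chat_one_nonneg k) m)
        (mul_le_one₀ (pow_le_one₀ (abs_nonneg _) (abs_Dhat_le_one k)) (abs_nonneg _)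
          (abs_DhatSym_le_one x k)))
    ?_
  · simpa using hlim
  · filter_upwards [ae_abs_Dhat_lt_one hd1] with k hk
    have h0 := tendsto_pow_atTop_nhds_zero_of_norm_lt_one (x := Dhat d k)
      (by rwa [Real.norm_eq_abs])
    have h1 : Tendsto (fun L : ℕ => Dhat d k ^ (l + L)) atTop (𝓝 0) := by
      have e : (fun L : ℕ => Dhat d k ^ (l + L)) = fun L => Dhat d k ^ l * Dhat d k ^ L := by
        funext L; rw [pow_add]
      rw [e]
      simpa using h0.const_mul (Dhat d k ^ l)
    simpa using (h1.mul_const (DhatSym d x k)).mul_const (Chat d 1 k ^ m)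

/-! ### Telescoping the recursion and passing to the limit -/

/-- `I_{n+1,l} = Σ_{i<L} I_{n,l+i} + I_{n+1,l+L}` ((5.1) iterated).
[cite: FitznerVanDerHofstad2016NoBLE, (5.1) p. 1090] -/
theorem srwI_succ_telescope {n : ℕ} (hd : 2 * (n + 1) + 1 ≤ d) (l : ℕ) (x : Fin d → ℤ) (L : ℕ) :
    srwI d (n + 1) l x =
      (∑ i ∈ Finset.range L, srwI d n (l + i) x) + srwI d (n + 1) (l + L) x := by
  induction L with
  | zero => simp
  | succ L ih =>
    rw [Finset.sum_range_succ, ← add_assoc l L 1, srwI_succ_succ hd (l + L) x]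
    linarith [ih]

/-- **PCM is inherited by `I_{n+1,·}` from `I_{n,·}`** (`d ≥ 2n + 3`). [folklore] -/
theorem parityMonotone_srwI_succ {n : ℕ} (hd : 2 * (n + 1) + 1 ≤ d)
    (ih : ∀ l, ParityMonotone (srwI d n l)) (l : ℕ) : ParityMonotone (srwI d (n + 1) l) := by
  intro z z' h
  have key : ∀ L : ℕ, srwI d (n + 1) l z - srwI d (n + 1) l z' ≤
      srwI d (n + 1) (l + L) z - srwI d (n + 1) (l + L) z' := by
    intro L
    rw [srwI_succ_telescope hd l z L, srwI_succ_telescope hd l z' L]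
    have := Finset.sum_le_sum fun i (_ : i ∈ Finset.range L) => ih (l + i) z z' h
    linarith
  have hlim : Tendsto (fun L : ℕ => srwI d (n + 1) (l + L) z - srwI d (n + 1) (l + L) z')
      atTop (𝓝 (0 - 0)) :=
    (tendsto_srwI_shift_atTop hd l z).sub (tendsto_srwI_shift_atTop hd l z')
  rw [sub_zero] at hlim
  have := ge_of_tendsto' hlim key
  linarith

/-- **PCM (parity-class monotonicity) for every `I_{n,l}`**, `d ≥ 2n + 1`: `I_{n,l}(z) ≤ I_{n,l}(z')`
whenever `|z'_μ| ≤ |z_μ|` and `z_μ ≡ z'_μ (mod 2)` for all `μ`.  This is the hypothesis of rule PCS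
(`SrwIntegralParityDomination`), now a theorem. (tail-g2 KSUP.md §9.1; REFEREE v12 R55 / N43a.)
[folklore] -/
theorem parityMonotone_srwI : ∀ (n : ℕ), 2 * n + 1 ≤ d → ∀ l, ParityMonotone (srwI d n l) := by
  intro n
  induction n with
  | zero => intro _ l; exact parityMonotone_srwI_zero l
  | succ n ih => intro hd l; exact parityMonotone_srwI_succ hd (fun l => ih (by omega) l) l

/-- **The PCM step** in the shape asked for by REFEREE v12 (N43a):
`I_{n,l}(y + 2e_ι) ≤ I_{n,l}(y)` whenever `y_ι ≥ -1` (`d ≥ 2n + 1`). [folklore] -/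
theorem srwI_parity_step {n : ℕ} (hd : 2 * n + 1 ≤ d) (l : ℕ) (y : Fin d → ℤ) (ι : Fin d)
    (hy : -1 ≤ y ι) : srwI d n l (y + axisVec ι 2) ≤ srwI d n l y := by
  refine parityMonotone_srwI n hd l _ _ fun μ => ?_
  by_cases hμ : μ = ι
  · subst hμ
    simp only [Pi.add_apply, axisVec, if_true, Int.abs_eq_natAbs]
    constructor <;> omega
  · simp [axisVec, hμ]

/-! ### Unconditional PCS reductions -/

/-- **PCS, W-level, unconditional**: `W_{n,j}(x) ≤ W_{n,j}(x*)`. [folklore] -/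
theorem srwW_le_srwW_parityRep' {n : ℕ} (hd : 2 * n + 1 ≤ d) (j : ℕ) (x : Fin d → ℤ) :
    srwW d n j x ≤ srwW d n j (parityRep x) :=
  srwW_le_srwW_parityRep hd j (parityMonotone_srwI n hd (2 * j)) x

/-- **PCS, W-level, axis, unconditional**: `W_{n,j}(a e_i) ≤ W_{n,j}(3 sgn(a) e_i)` for `a` odd,
`|a| ≥ 3`. [folklore] -/
theorem srwW_le_srwW_axis_three' {n : ℕ} (hd : 2 * n + 1 ≤ d) (j : ℕ) (i : Fin d) (a : ℤ)
    (ha : 3 ≤ |a|) (hodd : a % 2 = 1) :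
    srwW d n j (axisVec i a) ≤ srwW d n j (axisVec i (3 * Int.sign a)) :=
  srwW_le_srwW_axis_three hd j (parityMonotone_srwI n hd (2 * j)) i a ha hodd

/-- **PCS-K, unconditional**: `K_{n,m+j}(x) ≤ √I_{n,2m}(0) · √W_{n,j}(x*)` for every `x` — the sup of
`K_{n,l}` over the (infinite) parity class of `x` is carried by the single representative `x*`; with
`x*` ranging over the finitely many classes `1^{r₁}2^{r₂}`, `2e₁`, `3e₁` this makes the NoBLE
`sup_{x ≠ 0}` K-cells a finite certified maximum (b2b-lace KSUP.md §9, rule PCS-K). [folklore] -/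
theorem srwK_le_sqrt_srwW_parityRep' {n : ℕ} (hd : 2 * n + 1 ≤ d) (m j : ℕ) (x : Fin d → ℤ) :
    srwK d n (m + j) x ≤
      Real.sqrt (srwI d n (2 * m) 0) * Real.sqrt (srwW d n j (parityRep x)) :=
  srwK_le_sqrt_srwW_parityRep hd m j (parityMonotone_srwI n hd (2 * j)) x

/-- **PCS-K, axis, unconditional**: `K_{n,m+j}(a e_i) ≤ √I_{n,2m}(0) · √W_{n,j}(3 sgn(a) e_i)` for
`a` odd, `|a| ≥ 3`. [folklore] -/
theorem srwK_le_sqrt_srwW_axis_three' {n : ℕ} (hd : 2 * n + 1 ≤ d) (m j : ℕ) (i : Fin d) (a : ℤ)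
    (ha : 3 ≤ |a|) (hodd : a % 2 = 1) :
    srwK d n (m + j) (axisVec i a) ≤
      Real.sqrt (srwI d n (2 * m) 0) * Real.sqrt (srwW d n j (axisVec i (3 * Int.sign a))) :=
  srwK_le_sqrt_srwW_axis_three hd m j (parityMonotone_srwI n hd (2 * j)) i a ha hodd

end Literature.Probability.FitznerVanDerHofstad2017
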